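import Literature.Computability.Cryptography.LWEModulusSwitch
import Literature.Algebra.EuclideanLattices.StatDistCompose
import HarnessLib

/-!
# BLPRS 2013, Theorem 3.1 for `G = I` (= Corollary 3.2, modulus reduction) at the level of distributions

Topic `Computability/Cryptography` (family `pqc`). Layer L1 of the decomposition of the named fact
`Literature.Computability.Cryptography.blprs_gapSVP_sqrt_dim_to_lwe_classical` (**pqc.S21**; BLPRS,
STOC 2013): the modulus-switching component `h₃` of `BLPRSReduction.lean` runs **Corollary 3.2** (Thm. 3.1
with `n' = n`, `G = I`, `B = I/q'`), and "Theorem 3.1 follows immediately from Lemma 3.5" (p. 12) —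
namely by applying the single-sample map of Lemma 3.5 (`LWEModulusSwitch.lean`, PROVED there with its
two properties) independently to each of the `m` samples and accounting `4εm` (uniform side) and
`δ + 10εm` (`LWE` side: `10ε` per sample on the secrets of norm `≤ B`, probability `≤ δ` for the others).
This file PROVES that accounting on the tree's continuous-noise model (`torusLWESample`, `Ψ_γ`), with
the composition rules of `StatDistCompose.lean`. No named fact; the new `def`s are the `m`-sample laws
of Def. 2.11 / 2.14 and the `m`-fold transformation.

## The statement (arXiv:1306.0281 p. 11)

**Cor. 3.2.** For `m, n ≥ 1`, `q ≥ q' ≥ 1`, a `(B, δ)`-bounded `𝒟` over `ℤⁿ`, `α, β > 0`, `ε ∈ (0,1/2)`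
with `β² ≥ α² + (4/π) ln(2n(1+1/ε))·(B/q')²`, there is an efficient (transformation) reduction from
`LWE_{n,m,q,≤α}(𝒟)` to `LWE_{n,m,q',≤β}(𝒟)` that reduces the advantage by at most `δ + 14εm`. Here
`LWE_{n,m,q,φ}(𝒟)` (Def. 2.11) is: distinguish `m` uniform samples of `𝕋_qⁿ × 𝕋` from `m` samples of
`A_{q,s,φ}` for one `s ← 𝒟`; `LWE_{≤α}` (Def. 2.14) allows any noise rate `β(s) ≤ α` depending on the
secret; the advantage is `|Pr[𝒜(P₀)] - Pr[𝒜(P₁)]|` (§2).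

## Results

* General (`section General`): `lintegral_fin_prod_eq_prod` (Tonelli for `Measure.pi` over `Fin m`, `ℝ≥0∞`),
  `piKernel K m` (the same Markov kernel on each coordinate), `measurable_piKernel` (π-λ over boxes),
  **`pi_bind_piKernel`** (`(⊗ᵢμᵢ).bind K^{⊗m} = ⊗ᵢ(μᵢ.bind K)`), **`sum_smul_bind`** (a random parameter
  passes through a bind).
* Laws: `uniformInputs n q m = P₀`, `lweInputs n q m γ s = A_{q,s,D_γ}^{⊗m}`, **`lweInputsMix n q m 𝒟 β(·) = P₁`
  of `LWE_{n,m,q,≤α}(𝒟)`** for a rate function `β(·)` (the constraint `0 < β(s) ≤ α` is a hypothesis of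
  the theorems), `IsBoundedDist` (`(B,δ)`-bounded), `switchedRate` (the target rates: Lemma 3.5's
  `α'(s)` on good secrets, the bound itself on the `δ`-bad ones).
* The reduction `modSwitchOutputs m r B μ = μ.bind K^{⊗m}` and its closed forms on `P₀`
  (`modSwitchOutputs_uniformInputs`) and `P₁` (`modSwitchOutputs_lweInputsMix`).
* **Thm. 3.1 (`G = I`)**: `statDist_modSwitchOutputs_uniform_le` (`≤ 4εm`),
  `statDist_modSwitchOutputs_lwe_le` (`≤ δ + 10εm`), `advantage_sub_le` (**advantage drops by at most
  `δ + 14εm`**, for every measurable acceptance region), under Lemma 3.5's printed hypothesis on `r`.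
* **Cor. 3.2 as printed**: `corRadius n q' ε = q'⁻¹√(2 ln(2n(1+1/ε))/π)`, `corRadius_spec` (`q ≥ q'`),
  `switchedRate_pos_and_le` (the target rates are admissible: `0 < · ≤ β` from the printed condition on
  `β`), `corollary_3_2`, `corollary_3_2_advantage`.

## Conventions and scope

As in `LWEModulusSwitch.lean` (samples in `ℤ_qⁿ × 𝕋`, `s ∈ ℤⁿ` entering `mod q`, `D_γ ↦ Ψ_γ` on `𝕋`);
`𝒟` is a `PMF` on `Fin n → ℤ`; a distinguisher is represented by its (measurable) acceptance region —
randomised distinguishers are mixtures of such and obey the same bound. NOT here: the general `G`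
(Cor. 3.4), Lemma 2.15 (`≤ α` to `= α`), and the machine (finite-precision samplers, running time).

## References

* Z. Brakerski, A. Langlois, C. Peikert, O. Regev, D. Stehlé, *Classical hardness of learning with
  errors*, STOC 2013 = arXiv:1306.0281, §2 (advantage, transformation reductions), Def. 2.11, Def. 2.14,
  **Thm. 3.1, Cor. 3.2**, Lemma 3.5 [BrakerskiEtAl2013].
* O. Goldreich, *Foundations of Cryptography I*, CUP 2001, §3.2.3 (hybrid argument) [Goldreich2001].
-/

noncomputable section

open MeasureTheory ProbabilityTheory Module Literature.Algebra.EuclideanLattices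
  Literature.Algebra.EuclideanLattices.BLPRS2013
open scoped Real ENNReal InnerProductSpace NNReal

namespace Literature.Computability.Cryptography

namespace BLPRS2013

/-! ### General: applying a Markov kernel independently to `m` independent samples -/

section General

variable {X Y : Type*} [MeasurableSpace X] [MeasurableSpace Y]

/-- **Tonelli for finite products** (`ℝ≥0∞` form): the integral over `⊗ᵢ μᵢ` of a product of functions
of the separate coordinates is the product of the integrals. [folklore] -/
theorem lintegral_fin_prod_eq_prod :
    ∀ {m : ℕ} (μ : Fin m → Measure X) [∀ i, SigmaFinite (μ i)] (f : Fin m → X → ℝ≥0∞)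
      (_hf : ∀ i, Measurable (f i)),
      ∫⁻ x, ∏ i, f i (x i) ∂(Measure.pi μ) = ∏ i, ∫⁻ y, f i y ∂(μ i)
  | 0, μ, _, f, _ => by
      simp only [Finset.univ_eq_empty, Finset.prod_empty, lintegral_const, Measure.pi_univ, mul_one]
  | m + 1, μ, _, f, hf => by
      have hmp := measurePreserving_piFinSuccAbove μ 0
      set G : X × (Fin m → X) → ℝ≥0∞ :=
        fun yz => f 0 yz.1 * ∏ j, f (Fin.succAbove 0 j) (yz.2 j) with hG
      have hGm : Measurable G := by
        refine Measurable.mul ((hf 0).comp measurable_fst) ?_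
        exact Finset.measurable_fun_prod _ fun j _ =>
          (hf _).comp ((measurable_pi_apply j).comp measurable_snd)
      have hF : (fun x : Fin (m + 1) → X => ∏ i, f i (x i)) =
          fun x => G (MeasurableEquiv.piFinSuccAbove (fun _ : Fin (m + 1) => X) 0 x) := by
        funext x
        rw [Fin.prod_univ_succAbove _ 0]
        rfl
      have htail : Measurable fun z : Fin m → X => ∏ j, f (Fin.succAbove 0 j) (z j) :=
        Finset.measurable_fun_prod _ fun j _ => (hf _).comp (measurable_pi_apply j)
      rw [hF, hmp.lintegral_comp hGm, lintegral_prod _ hGm.aemeasurable, Fin.prod_univ_succAbove _ 0]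
      simp only [hG]
      have hin : ∀ y : X, ∫⁻ z, f 0 y * ∏ j, f (Fin.succAbove 0 j) (z j)
          ∂(Measure.pi fun j => μ (Fin.succAbove 0 j)) =
          f 0 y * ∏ j, ∫⁻ y', f (Fin.succAbove 0 j) y' ∂(μ (Fin.succAbove 0 j)) := by
        intro y
        rw [lintegral_const_mul _ htail,
          lintegral_fin_prod_eq_prod (fun j => μ (Fin.succAbove 0 j)) (fun j => f (Fin.succAbove 0 j))
            fun j => hf _]
      simp_rw [hin]
      rw [lintegral_mul_const _ (hf 0)]

/-- The `m`-fold kernel: the same Markov kernel applied independently to each of `m` coordinates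
("transformation reductions … perform some transformation to [each sample of] the input"). [cite: BrakerskiEtAl2013, §2 ("transformation reductions") and Thm. 3.1] -/
def piKernel (K : X → Measure Y) (m : ℕ) (p : Fin m → X) : Measure (Fin m → Y) :=
  Measure.pi fun i => K (p i)

/-- The `m`-fold kernel of a Markov kernel is Markov. [folklore] -/
instance isProbabilityMeasure_piKernel (K : X → Measure Y) [∀ x, IsProbabilityMeasure (K x)] (m : ℕ)
    (p : Fin m → X) : IsProbabilityMeasure (piKernel K m p) := by
  unfold piKernel; infer_instance

/-- **The `m`-fold kernel of a measurable Markov kernel is measurable** (π-λ over boxes: on a box it is a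
finite product of measurable functions; complements and disjoint unions by total mass one and
σ-additivity). [folklore] -/
theorem measurable_piKernel {K : X → Measure Y} (hK : Measurable K) [∀ x, IsProbabilityMeasure (K x)]
    (m : ℕ) : Measurable (piKernel K m) := by
  refine Measure.measurable_of_measurable_coe _ fun S hS => ?_
  refine MeasurableSpace.induction_on_inter (C := fun S _ => Measurable fun p => piKernel K m p S)
    generateFrom_pi.symm isPiSystem_pi ?_ ?_ ?_ ?_ S hS
  · simp
  · rintro t ⟨A, hA, rfl⟩
    have hA' : ∀ i, MeasurableSet (A i) := fun i => hA i (Set.mem_univ i)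
    have h : (fun p : Fin m → X => piKernel K m p (Set.pi Set.univ A)) =
        fun p => ∏ i, K (p i) (A i) := by
      funext p
      rw [piKernel, Measure.pi_pi]
    rw [h]
    exact Finset.measurable_fun_prod _ fun i _ =>
      (Measure.measurable_coe (hA' i)).comp (hK.comp (measurable_pi_apply i))
  · intro t htm ih
    have h : (fun p : Fin m → X => piKernel K m p tᶜ) = fun p => 1 - piKernel K m p t := by
      funext p
      exact prob_compl_eq_one_sub htm
    rw [h]
    exact measurable_const.sub ih
  · intro f hdisj hfm ih
    have h : (fun p : Fin m → X => piKernel K m p (⋃ i, f i)) =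
        fun p => ∑' i, piKernel K m p (f i) := by
      funext p
      exact measure_iUnion hdisj hfm
    rw [h]
    exact Measurable.tsum ih

/-- **Independent inputs give independent outputs**: `(⊗ᵢ μᵢ).bind K^{⊗m} = ⊗ᵢ (μᵢ.bind K)`.
[folklore] -/
theorem pi_bind_piKernel {K : X → Measure Y} (hK : Measurable K) [∀ x, IsProbabilityMeasure (K x)]
    {m : ℕ} (μ : Fin m → Measure X) [∀ i, IsProbabilityMeasure (μ i)] :
    (Measure.pi μ).bind (piKernel K m) = Measure.pi fun i => (μ i).bind K := by
  haveI : ∀ i, IsProbabilityMeasure ((fun i => (μ i).bind K) i) := fun i => by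
    constructor
    rw [Measure.bind_apply MeasurableSet.univ hK.aemeasurable]
    simp
  refine (Measure.pi_eq fun A hA => ?_).symm
  rw [Measure.bind_apply (MeasurableSet.univ_pi hA) (measurable_piKernel hK m).aemeasurable]
  have h : (fun p : Fin m → X => piKernel K m p (Set.pi Set.univ A)) =
      fun p => ∏ i, (fun i x => K x (A i)) i (p i) := by
    funext p
    rw [piKernel, Measure.pi_pi]
  rw [h, lintegral_fin_prod_eq_prod μ (fun i x => K x (A i)) fun i =>
    (Measure.measurable_coe (hA i)).comp hK]
  refine Finset.prod_congr rfl fun i _ => ?_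
  rw [Measure.bind_apply (hA i) hK.aemeasurable]

omit [MeasurableSpace X] in
/-- **A random parameter passes through**: binding a mixture is the mixture of the binds. [folklore] -/
theorem sum_smul_bind {S : Type*} {Z : Type*} [MeasurableSpace Z] (w : S → ℝ≥0∞) (μ : S → Measure Z)
    {K : Z → Measure Y} (hK : Measurable K) :
    (Measure.sum fun s => w s • μ s).bind K = Measure.sum fun s => w s • (μ s).bind K := by
  ext T hT
  rw [Measure.bind_apply hT hK.aemeasurable, lintegral_sum_measure, Measure.sum_apply _ hT]
  refine tsum_congr fun s => ?_
  rw [lintegral_smul_measure, Measure.smul_apply, Measure.bind_apply hT hK.aemeasurable, smul_eq_mul]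

end General

/-! ### The `m`-sample laws of `LWE_{n,m,q,φ}(𝒟)` / `LWE_{n,m,q,≤α}(𝒟)` (Def. 2.11, Def. 2.14) -/

section Laws

variable (n q : ℕ) [NeZero q] (m : ℕ)

/-- `P₀` of `LWE_{n,m,q,·}`: `m` independent uniform samples of `ℤ_qⁿ × 𝕋`. [cite: BrakerskiEtAl2013, Def. 2.11] -/
def uniformInputs : Measure (Fin m → (Fin n → ZMod q) × UnitAddCircle) :=
  Measure.pi fun _ => uniformInput n q

/-- `P₀` is a probability measure. [folklore] -/
instance isProbabilityMeasure_uniformInputs : IsProbabilityMeasure (uniformInputs n q m) := by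
  unfold uniformInputs; infer_instance

/-- `m` independent samples of `A_{q,s,D_γ}` for an integer secret `s` (entering `mod q`).
[cite: BrakerskiEtAl2013, §2.3 and Def. 2.11] -/
def lweInputs (γ : ℝ) (s : Fin n → ℤ) : Measure (Fin m → (Fin n → ZMod q) × UnitAddCircle) :=
  Measure.pi fun _ => LWE.torusLWESample q (LWE.wrappedGaussian γ) fun j => (s j : ZMod q)

/-- `A_{q,s,D_γ}^{⊗m}` is a probability measure. [folklore] -/
instance isProbabilityMeasure_lweInputs (γ : ℝ) (s : Fin n → ℤ) :
    IsProbabilityMeasure (lweInputs n q m γ s) := by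
  unfold lweInputs; infer_instance

/-- `P₁` of `LWE_{n,m,q,≤α}(𝒟)` (Def. 2.11 with Def. 2.14): a secret `s ← 𝒟` (a distribution over `ℤⁿ`),
then `m` independent samples of `A_{q,s,D_{β(s)}}` for a noise rate `β(s)` that may depend on the
secret ("`LWE_{n,q,≤α}` is the problem of solving `LWE_{n,q,β}` for any `β = β(s) ≤ α`"; the constraint
`β ≤ α` is put on the rate function in the theorems). [cite: BrakerskiEtAl2013, Def. 2.11 and Def. 2.14] -/
def lweInputsMix (D : PMF (Fin n → ℤ)) (rate : (Fin n → ℤ) → ℝ) :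
    Measure (Fin m → (Fin n → ZMod q) × UnitAddCircle) :=
  Measure.sum fun s => D s • lweInputs n q m (rate s) s

/-- `P₁` is a probability measure. [folklore] -/
instance isProbabilityMeasure_lweInputsMix (D : PMF (Fin n → ℤ)) (rate : (Fin n → ℤ) → ℝ) :
    IsProbabilityMeasure (lweInputsMix n q m D rate) := by
  constructor
  rw [lweInputsMix, Measure.sum_apply _ MeasurableSet.univ]
  simp [PMF.tsum_coe]

/-- **`(B, δ)`-bounded** secret distributions: "the probability that `x ← 𝒟` has norm greater than `B` is
at most `δ`". [cite: BrakerskiEtAl2013, §3 (before Thm. 3.1)] -/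
def IsBoundedDist (D : PMF (Fin n → ℤ)) (B δ : ℝ) : Prop :=
  (D.toOuterMeasure {s | B < ‖intVecToEuclidean n s‖}).toReal ≤ δ

/-- The noise rates of the TARGET problem: for a good secret (`‖s‖ ≤ B`) the rate `α'(s)` of Lemma 3.5,
`α'(s)² = β(s)² + r²(‖s‖² + B²)`; for a bad secret (probability `≤ δ`) any admissible value, here the
bound `β'` itself — this cutoff is where the `δ` of "`δ + 14εm`" is spent. [cite: BrakerskiEtAl2013, Thm. 3.1 (proof: "follows immediately from Lemma 3.5")] -/
def switchedRate (r B β' : ℝ) (rate : (Fin n → ℤ) → ℝ) (s : Fin n → ℤ) : ℝ :=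
  if ‖intVecToEuclidean n s‖ ≤ B then
    Real.sqrt (rate s ^ 2 + r ^ 2 * (‖intVecToEuclidean n s‖ ^ 2 + B ^ 2))
  else β'

end Laws

/-! ### The reduction on `m` samples and its two distance bounds -/

section Reduction

variable {n q q' : ℕ} [NeZero q] [NeZero q'] {m : ℕ}

/-- The output of the single-sample map on a probability input is a probability measure. [folklore] -/
instance isProbabilityMeasure_modSwitchOutput (r B : ℝ) (μ : Measure ((Fin n → ZMod q) × UnitAddCircle))
    [IsProbabilityMeasure μ] : IsProbabilityMeasure (modSwitchOutput (q' := q') r B μ) := by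
  constructor
  rw [modSwitchOutput_apply r B μ MeasurableSet.univ]
  simp

variable (m) in
/-- **The reduction of Thm. 3.1 / Cor. 3.2 (`G = I`) on `m` samples**: the map of Lemma 3.5 applied
independently to each sample of the input (a transformation reduction). [cite: BrakerskiEtAl2013, Thm. 3.1 and §2 ("transformation reductions")] -/
def modSwitchOutputs (r B : ℝ) (μ : Measure (Fin m → (Fin n → ZMod q) × UnitAddCircle)) :
    Measure (Fin m → (Fin n → ZMod q') × UnitAddCircle) :=
  μ.bind (piKernel (modSwitchKernel n q q' r B) m)

/-- The `m`-sample output of a probability input is a probability measure. [folklore] -/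
instance isProbabilityMeasure_modSwitchOutputs (r B : ℝ)
    (μ : Measure (Fin m → (Fin n → ZMod q) × UnitAddCircle)) [IsProbabilityMeasure μ] :
    IsProbabilityMeasure (modSwitchOutputs (q' := q') m r B μ) := by
  constructor
  rw [modSwitchOutputs, Measure.bind_apply MeasurableSet.univ
    (measurable_piKernel (measurable_modSwitchKernel r B) m).aemeasurable]
  simp

/-- **On independent uniform samples the output is the `m`-fold power of the single-sample output.**
[folklore] -/
theorem modSwitchOutputs_uniformInputs (r B : ℝ) :
    modSwitchOutputs (q' := q') m r B (uniformInputs n q m) =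
      Measure.pi fun _ : Fin m => modSwitchOutput r B (uniformInput n q) :=
  pi_bind_piKernel (measurable_modSwitchKernel r B) _

/-- **On `P₁` the output is the same mixture over the secret of `m`-fold powers of single-sample
outputs.** [folklore] -/
theorem modSwitchOutputs_lweInputsMix (r B : ℝ) (D : PMF (Fin n → ℤ)) (rate : (Fin n → ℤ) → ℝ) :
    modSwitchOutputs (q' := q') m r B (lweInputsMix n q m D rate) =
      Measure.sum fun s => D s • Measure.pi fun _ : Fin m =>
        modSwitchOutput r B (LWE.torusLWESample q (LWE.wrappedGaussian (rate s)) fun j => (s j : ZMod q)) := by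
  rw [modSwitchOutputs, lweInputsMix,
    sum_smul_bind _ _ (measurable_piKernel (measurable_modSwitchKernel r B) m)]
  congr 1
  funext s
  rw [lweInputs, pi_bind_piKernel (measurable_modSwitchKernel r B)]
  rfl

/-- **Thm. 3.1 (`G = I`), the uniform side**: `m` uniform samples are mapped to within `4εm` of `m` uniform
samples (Lemma 3.5 (i) and the hybrid bound). [cite: BrakerskiEtAl2013, Thm. 3.1 with Lemma 3.5 (first property)] -/
theorem statDist_modSwitchOutputs_uniform_le {ε r : ℝ} (B : ℝ) (hn : 0 < n) (hε : 0 < ε) (hε' : ε ≤ 1 / 2)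
    (hr : max (q : ℝ)⁻¹ (q' : ℝ)⁻¹ * Real.sqrt (2 * Real.log (2 * n * (1 + 1 / ε)) / π) ≤ r) :
    statDist (modSwitchOutputs m r B (uniformInputs n q m)) (uniformInputs n q' m) ≤ 4 * ε * m := by
  rw [modSwitchOutputs_uniformInputs, uniformInputs]
  refine (statDist_pi_le_sum _ _).trans ?_
  calc ∑ _i : Fin m, statDist (modSwitchOutput r B (uniformInput n q)) (uniformInput n q')
      ≤ ∑ _i : Fin m, 4 * ε :=
        Finset.sum_le_sum fun i _ => statDist_modSwitchOutput_uniform_le B hn hε hε' hr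
    _ = 4 * ε * m := by rw [Finset.sum_const, Finset.card_univ, Fintype.card_fin, nsmul_eq_mul]; ring

/-- **Thm. 3.1 (`G = I`), the `LWE` side**: for a `(B, δ)`-bounded secret distribution and any positive
rate function, `P₁` is mapped to within `δ + 10εm` of the `P₁` of the target problem with rates
`switchedRate` (Lemma 3.5 (ii) on the good secrets and the hybrid bound; the bad secrets cost `δ`).
[cite: BrakerskiEtAl2013, Thm. 3.1 with Lemma 3.5 (second property)] -/
theorem statDist_modSwitchOutputs_lwe_le {ε r B δ : ℝ} (β' : ℝ) (hn : 0 < n) (hε : 0 < ε)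
    (hε' : ε ≤ 1 / 2)
    (hr : max (q : ℝ)⁻¹ (q' : ℝ)⁻¹ * Real.sqrt (2 * Real.log (2 * n * (1 + 1 / ε)) / π) ≤ r)
    {D : PMF (Fin n → ℤ)} (hD : IsBoundedDist n D B δ) {rate : (Fin n → ℤ) → ℝ}
    (hrate : ∀ s, 0 < rate s) :
    statDist (modSwitchOutputs m r B (lweInputsMix n q m D rate))
        (lweInputsMix n q' m D (switchedRate n r B β' rate)) ≤ δ + 10 * ε * m := by
  rw [modSwitchOutputs_lweInputsMix, lweInputsMix]
  simp only [lweInputs]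
  refine (statDist_sum_smul_le D D.tsum_coe _ _).trans ?_
  set bad : Set (Fin n → ℤ) := {s | B < ‖intVecToEuclidean n s‖} with hbad
  set c : ℝ≥0∞ := ENNReal.ofReal (10 * ε * m) with hc
  -- good secrets: Lemma 3.5 (ii) on every coordinate
  have hgood : ∀ s : Fin n → ℤ, ‖intVecToEuclidean n s‖ ≤ B →
      statDist (Measure.pi fun _ : Fin m => modSwitchOutput (q' := q') r B
          (LWE.torusLWESample q (LWE.wrappedGaussian (rate s)) fun j => (s j : ZMod q)))
        (Measure.pi fun _ : Fin m => LWE.torusLWESample q'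
          (LWE.wrappedGaussian (switchedRate n r B β' rate s)) fun j => (s j : ZMod q')) ≤ 10 * ε * m := by
    intro s hs
    refine (statDist_pi_le_sum _ _).trans ?_
    have h1 := statDist_modSwitchOutput_lwe_le (q := q) (q' := q') (B := B) hn hε hε' hr (hrate s) s hs
    rw [switchedRate, if_pos hs]
    calc ∑ _i : Fin m, statDist (modSwitchOutput (q' := q') r B
            (LWE.torusLWESample q (LWE.wrappedGaussian (rate s)) fun j => (s j : ZMod q)))
          (LWE.torusLWESample q' (LWE.wrappedGaussian
            (Real.sqrt (rate s ^ 2 + r ^ 2 * (‖intVecToEuclidean n s‖ ^ 2 + B ^ 2)))) fun j => (s j : ZMod q'))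
        ≤ ∑ _i : Fin m, 10 * ε := Finset.sum_le_sum fun i _ => h1
      _ = 10 * ε * m := by rw [Finset.sum_const, Finset.card_univ, Fintype.card_fin, nsmul_eq_mul]; ring
  -- pointwise bound of the weighted distances
  have hpt : ∀ s : Fin n → ℤ, (D s : ℝ≥0∞) * ENNReal.ofReal (statDist
      (Measure.pi fun _ : Fin m => modSwitchOutput (q' := q') r B
          (LWE.torusLWESample q (LWE.wrappedGaussian (rate s)) fun j => (s j : ZMod q)))
        (Measure.pi fun _ : Fin m => LWE.torusLWESample q'
          (LWE.wrappedGaussian (switchedRate n r B β' rate s)) fun j => (s j : ZMod q'))) ≤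
      D s * c + bad.indicator D s := by
    intro s
    by_cases hs : ‖intVecToEuclidean n s‖ ≤ B
    · have : bad.indicator (⇑D) s = 0 := Set.indicator_of_notMem (by simp [hbad, hs]) _
      rw [this, add_zero]
      exact mul_le_mul_right (ENNReal.ofReal_le_ofReal (hgood s hs)) _
    · have : bad.indicator (⇑D) s = D s := Set.indicator_of_mem (by simp [hbad, not_le.1 hs]) _
      rw [this]
      calc (D s : ℝ≥0∞) * ENNReal.ofReal _ ≤ D s * 1 :=
            mul_le_mul_right (ENNReal.ofReal_le_one.2 (statDist_le_one _ _)) _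
        _ ≤ D s * c + D s := by rw [mul_one]; exact le_add_self
  have hsum : (∑' s, (D s : ℝ≥0∞) * ENNReal.ofReal (statDist
      (Measure.pi fun _ : Fin m => modSwitchOutput (q' := q') r B
          (LWE.torusLWESample q (LWE.wrappedGaussian (rate s)) fun j => (s j : ZMod q)))
        (Measure.pi fun _ : Fin m => LWE.torusLWESample q'
          (LWE.wrappedGaussian (switchedRate n r B β' rate s)) fun j => (s j : ZMod q')))) ≤
      c + D.toOuterMeasure bad := by
    calc _ ≤ ∑' s, ((D s : ℝ≥0∞) * c + bad.indicator D s) := ENNReal.tsum_le_tsum hpt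
      _ = (∑' s, (D s : ℝ≥0∞)) * c + ∑' s, bad.indicator D s := by
          rw [ENNReal.tsum_add, ENNReal.tsum_mul_right]
      _ = c + D.toOuterMeasure bad := by rw [PMF.tsum_coe, one_mul, PMF.toOuterMeasure_apply]
  have hbad1' : D.toOuterMeasure bad ≤ 1 := by
    rw [PMF.toOuterMeasure_apply, ← D.tsum_coe]
    exact ENNReal.tsum_le_tsum fun s => Set.indicator_le_self bad (⇑D) s
  have hbad1 : D.toOuterMeasure bad ≠ ∞ := ne_top_of_le_ne_top ENNReal.one_ne_top hbad1'
  have hfin : c + D.toOuterMeasure bad ≠ ∞ := ENNReal.add_ne_top.2 ⟨ENNReal.ofReal_ne_top, hbad1⟩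
  calc (∑' s, (D s : ℝ≥0∞) * ENNReal.ofReal _).toReal ≤ (c + D.toOuterMeasure bad).toReal :=
        ENNReal.toReal_mono hfin hsum
    _ = 10 * ε * m + (D.toOuterMeasure bad).toReal := by
        rw [ENNReal.toReal_add ENNReal.ofReal_ne_top hbad1, ENNReal.toReal_ofReal (by positivity)]
    _ ≤ δ + 10 * ε * m := by
        have : (D.toOuterMeasure bad).toReal ≤ δ := hD
        linarith

/-- **The advantage form** ("reduces the advantage by at most `δ + 14εm`"): for every measurable
acceptance region `Acc` of a distinguisher for the target problem, the distinguisher run on the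
transformed samples has, against `(P₀, P₁)` of the source problem, advantage at least its advantage
against the target pair minus `δ + 14εm`. [cite: BrakerskiEtAl2013, Thm. 3.1 ("reduces the advantage by at most `δ + 14εm`")] -/
theorem advantage_sub_le {ε r B δ : ℝ} (β' : ℝ) (hn : 0 < n) (hε : 0 < ε) (hε' : ε ≤ 1 / 2)
    (hr : max (q : ℝ)⁻¹ (q' : ℝ)⁻¹ * Real.sqrt (2 * Real.log (2 * n * (1 + 1 / ε)) / π) ≤ r)
    {D : PMF (Fin n → ℤ)} (hD : IsBoundedDist n D B δ) {rate : (Fin n → ℤ) → ℝ}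
    (hrate : ∀ s, 0 < rate s) {Acc : Set (Fin m → (Fin n → ZMod q') × UnitAddCircle)}
    (hAcc : MeasurableSet Acc) :
    |(uniformInputs n q' m).real Acc - (lweInputsMix n q' m D (switchedRate n r B β' rate)).real Acc| -
        (δ + 14 * ε * m) ≤
      |(modSwitchOutputs m r B (uniformInputs n q m)).real Acc -
        (modSwitchOutputs m r B (lweInputsMix n q m D rate)).real Acc| := by
  have h0 := abs_measureReal_sub_le_statDist (modSwitchOutputs (q' := q') m r B (uniformInputs n q m))
    (uniformInputs n q' m) hAcc
  have h1 := abs_measureReal_sub_le_statDist (modSwitchOutputs (q' := q') m r B (lweInputsMix n q m D rate))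
    (lweInputsMix n q' m D (switchedRate n r B β' rate)) hAcc
  have hU := statDist_modSwitchOutputs_uniform_le (q := q) (q' := q') (m := m) B hn hε hε' hr
  have hL := statDist_modSwitchOutputs_lwe_le (q := q) (q' := q') (m := m) β' hn hε hε' hr hD hrate
  set a₀ := (modSwitchOutputs (q' := q') m r B (uniformInputs n q m)).real Acc
  set a₁ := (modSwitchOutputs (q' := q') m r B (lweInputsMix n q m D rate)).real Acc
  set b₀ := (uniformInputs n q' m).real Acc
  set b₁ := (lweInputsMix n q' m D (switchedRate n r B β' rate)).real Acc
  have key : |b₀ - b₁| ≤ |a₀ - a₁| + |a₀ - b₀| + |a₁ - b₁| := by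
    calc |b₀ - b₁| = |(a₀ - a₁) - (a₀ - b₀) + (a₁ - b₁)| := by ring_nf
      _ ≤ |(a₀ - a₁) - (a₀ - b₀)| + |a₁ - b₁| := abs_add_le _ _
      _ ≤ |a₀ - a₁| + |a₀ - b₀| + |a₁ - b₁| := by linarith [abs_sub (a₀ - a₁) (a₀ - b₀)]
  linarith

/-! ### Corollary 3.2 as printed (`q ≥ q'`, `r = q'⁻¹√(2 ln(2n(1+1/ε))/π)`) -/

variable (n q') in
/-- The radius of Cor. 3.2: `r = q'⁻¹ √(2 ln(2n(1+1/ε))/π)`, i.e. equality in Lemma 3.5's hypothesis when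
`q ≥ q'` (so that `2(rB)² = (4/π) ln(2n(1+1/ε))·(B/q')²`). [cite: BrakerskiEtAl2013, Cor. 3.2] -/
def corRadius (ε : ℝ) : ℝ := (q' : ℝ)⁻¹ * Real.sqrt (2 * Real.log (2 * n * (1 + 1 / ε)) / π)

omit [NeZero q] in
/-- For `q ≥ q'` the radius of Cor. 3.2 satisfies the hypothesis of Lemma 3.5 / Thm. 3.1. [cite: BrakerskiEtAl2013, Cor. 3.2] -/
theorem corRadius_spec (hqq' : q' ≤ q) (ε : ℝ) :
    max (q : ℝ)⁻¹ (q' : ℝ)⁻¹ * Real.sqrt (2 * Real.log (2 * n * (1 + 1 / ε)) / π) ≤ corRadius n q' ε := by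
  have hq' : (0 : ℝ) < q' := by exact_mod_cast Nat.pos_of_ne_zero (NeZero.ne q')
  have hle : (q : ℝ)⁻¹ ≤ (q' : ℝ)⁻¹ := inv_anti₀ hq' (by exact_mod_cast hqq')
  rw [corRadius, max_eq_right hle]

omit [NeZero q] [NeZero q'] in
/-- **The target rates are admissible for `LWE_{n,m,q',≤β}(𝒟)`** under the printed condition
`β² ≥ α² + (4/π) ln(2n(1+1/ε)) (B/q')²`: `0 < switchedRate ≤ β` for every secret. [cite: BrakerskiEtAl2013, Cor. 3.2 (the condition on `β`)] -/
theorem switchedRate_pos_and_le {ε α β B : ℝ} (hn : 0 < n) (hε : 0 < ε) (hβ : 0 < β)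
    (hβ2 : α ^ 2 + 4 / π * Real.log (2 * n * (1 + 1 / ε)) * (B / q') ^ 2 ≤ β ^ 2)
    {rate : (Fin n → ℤ) → ℝ} (hrate0 : ∀ s, 0 < rate s) (hrateα : ∀ s, rate s ≤ α) (s : Fin n → ℤ) :
    0 < switchedRate n (corRadius n q' ε) B β rate s ∧ switchedRate n (corRadius n q' ε) B β rate s ≤ β := by
  rw [switchedRate]
  split_ifs with hs
  · have hlog : 0 ≤ Real.log (2 * n * (1 + 1 / ε)) := by
      refine (Real.log_pos ?_).le
      have hn1 : (1 : ℝ) ≤ n := by exact_mod_cast hn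
      have : (1 : ℝ) < 1 + 1 / ε := by
        have := one_div_pos.2 hε
        linarith
      nlinarith
    have hr2 : corRadius n q' ε ^ 2 = (q' : ℝ)⁻¹ ^ 2 * (2 * Real.log (2 * n * (1 + 1 / ε)) / π) := by
      rw [corRadius, mul_pow, Real.sq_sqrt (by positivity)]
    have hX : rate s ^ 2 + corRadius n q' ε ^ 2 * (‖intVecToEuclidean n s‖ ^ 2 + B ^ 2) ≤ β ^ 2 := by
      have h1 : rate s ^ 2 ≤ α ^ 2 := pow_le_pow_left₀ (hrate0 s).le (hrateα s) 2
      have h2 : ‖intVecToEuclidean n s‖ ^ 2 ≤ B ^ 2 := pow_le_pow_left₀ (norm_nonneg _) hs 2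
      have h3 : corRadius n q' ε ^ 2 * (‖intVecToEuclidean n s‖ ^ 2 + B ^ 2) ≤
          corRadius n q' ε ^ 2 * (B ^ 2 + B ^ 2) :=
        mul_le_mul_of_nonneg_left (by linarith) (sq_nonneg _)
      have h4 : corRadius n q' ε ^ 2 * (B ^ 2 + B ^ 2) =
          4 / π * Real.log (2 * n * (1 + 1 / ε)) * (B / q') ^ 2 := by
        rw [hr2]; ring
      linarith
    refine ⟨Real.sqrt_pos.2 (by have := hrate0 s; positivity), ?_⟩
    calc Real.sqrt (rate s ^ 2 + corRadius n q' ε ^ 2 * (‖intVecToEuclidean n s‖ ^ 2 + B ^ 2))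
        ≤ Real.sqrt (β ^ 2) := Real.sqrt_le_sqrt hX
      _ = β := Real.sqrt_sq hβ.le
  · exact ⟨hβ, le_rfl⟩

/-- **BLPRS 2013, Corollary 3.2 (modulus reduction), distributional form.** Let `m, n ≥ 1`, `q ≥ q' ≥ 1`,
`𝒟` a `(B, δ)`-bounded distribution over `ℤⁿ`, `α, β > 0`, `ε ∈ (0, 1/2]`, with
`β² ≥ α² + (4/π) ln(2n(1+1/ε)) · (B/q')²`, and let the source noise rates satisfy `0 < β(s) ≤ α`
(`LWE_{n,m,q,≤α}(𝒟)`). Then the transformation `modSwitchOutputs` with `r = corRadius` maps `P₀` (uniform)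
to within `4εm` of uniform and `P₁` to within `δ + 10εm` of the `P₁` of `LWE_{n,m,q',≤β}(𝒟)` with the
admissible rates `switchedRate ≤ β` (`switchedRate_pos_and_le`); hence (`advantage_sub_le`) it "reduces
the advantage by at most `δ + 14εm`". [cite: BrakerskiEtAl2013, Cor. 3.2] -/
theorem corollary_3_2 {ε β B δ : ℝ} (hn : 0 < n) (hqq' : q' ≤ q) (hε : 0 < ε) (hε' : ε ≤ 1 / 2)
    {D : PMF (Fin n → ℤ)} (hD : IsBoundedDist n D B δ) {rate : (Fin n → ℤ) → ℝ}
    (hrate0 : ∀ s, 0 < rate s) :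
    statDist (modSwitchOutputs m (corRadius n q' ε) B (uniformInputs n q m)) (uniformInputs n q' m) ≤
        4 * ε * m ∧
      statDist (modSwitchOutputs m (corRadius n q' ε) B (lweInputsMix n q m D rate))
          (lweInputsMix n q' m D (switchedRate n (corRadius n q' ε) B β rate)) ≤ δ + 10 * ε * m :=
  ⟨statDist_modSwitchOutputs_uniform_le B hn hε hε' (corRadius_spec hqq' ε),
    statDist_modSwitchOutputs_lwe_le β hn hε hε' (corRadius_spec hqq' ε) hD hrate0⟩

/-- **Corollary 3.2, advantage form**: with `r = corRadius`, every acceptance region loses at most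
`δ + 14εm` of advantage. [cite: BrakerskiEtAl2013, Cor. 3.2 ("reduces the advantage by at most `δ + 14εm`")] -/
theorem corollary_3_2_advantage {ε β B δ : ℝ} (hn : 0 < n) (hqq' : q' ≤ q) (hε : 0 < ε)
    (hε' : ε ≤ 1 / 2) {D : PMF (Fin n → ℤ)} (hD : IsBoundedDist n D B δ) {rate : (Fin n → ℤ) → ℝ}
    (hrate0 : ∀ s, 0 < rate s) {Acc : Set (Fin m → (Fin n → ZMod q') × UnitAddCircle)}
    (hAcc : MeasurableSet Acc) :
    |(uniformInputs n q' m).real Acc -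
          (lweInputsMix n q' m D (switchedRate n (corRadius n q' ε) B β rate)).real Acc| -
        (δ + 14 * ε * m) ≤
      |(modSwitchOutputs m (corRadius n q' ε) B (uniformInputs n q m)).real Acc -
        (modSwitchOutputs m (corRadius n q' ε) B (lweInputsMix n q m D rate)).real Acc| :=
  advantage_sub_le β hn hε hε' (corRadius_spec hqq' ε) hD hrate0 hAcc

end Reduction

end BLPRS2013

end Literature.Computability.Cryptography

end
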